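import Summits.CriticalPhenomena.PercolationContinuityZ3.Theorems.PercNearOneGluingNoHeavyPcintChordMemSym
import Summits.CriticalPhenomena.PercolationContinuityZ3.Theorems.PercNearOneGluingNoHeavyPcintNawRandMemKernelCert
import Summits.CriticalPhenomena.PercolationContinuityZ3.Theorems.PercNearOneGluingNoHeavyPcintNawRandMemKernelSymTab
import HarnessLib

/-!
# PCINT lane, reduced-state B3r certificates (bond): the computable (kernel) layer — step, counts, corner flag

Cell `prim-pcint` (PAPER-2 track (iii)), seat `prim-pcint-2` (gen 4); support file (`--supports stmt-CriticalPhenomena-4575`).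
Does NOT build on p205010.  Kernel-evaluable mirrors (`decide +kernel`, natural-number and integer-list arithmetic only) of
the objects of `…PcintChordMem` on the kernel states `NawK.KState` of `…PcintNawRandMemKernel` (prim-pcint-1 gen 5, whose
integer-list geometry, symmetry tables and set comparison are reused): the SAW step `BondK.mstepK` (mirror of `mstep`), the
detected chord count `BondK.bchordK`, the detected gap count `BondK.bgapK`, the claimed corner `BondK.bcornerK`, with the
SOUNDNESS bridges `BondK.mstep_toM` (`mstep τ (toM L) a = (mstepK τ d L a).map toM`), `BondK.bchordK_le_bchord`,
`BondK.bgapK_le_bgap`, `BondK.bcorner_of_bcornerK` (the kernel never over-charges: fewer chords/gaps and fewer corner claims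
than the semantic automaton only make the certified weights larger).  The table format, the row check and the final
assembly are in `…PcintChordMemKernelCert`.
-/

namespace Summit.CriticalPhenomena.PercolationContinuityZ3.Theorems.Pcint

open Finset Literature.Probability.Percolation Literature.Probability.LatticeModels

namespace BondK

open WinK (toSite toL addL adjL toSite_addL toSite_toL adj_iff_adjL toSite_inj length_toL length_addL)
open NawK (KState toM mem_toM WF length_of_WF letters mem_letters nodup_letters negL subL l1L length_negL length_subL
  toSite_negL toSite_subL l1_toSite)

variable {d : ℕ}

/-! ### The kernel step, counts and corner flag -/

/-- Kernel SAW step on dangerous-set states (mirror of `mstep`): refused iff the new vertex is a remembered site; otherwise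
shift, age, insert the site just left, and drop sites out of reach. [folklore] -/
def mstepK (τ d : ℕ) (L : KState) (a : Fin d × Bool) : Option KState :=
  if L.any (fun q => decide (q.1 = toL d a)) then none
  else some ((negL (toL d a), 1) :: L.filterMap fun q =>
    if q.2 + 1 ≤ τ - 1 ∧ l1L (subL q.1 (toL d a)) ≤ τ - (q.2 + 1) then some (subL q.1 (toL d a), q.2 + 1) else none)

/-- Kernel detected chord count (capped form: the number of LETTERS `b` whose site `e_a + e_b` is remembered; at most `2d`).
[folklore] -/
def bchordK (d : ℕ) (L : KState) (a : Fin d × Bool) : ℕ :=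
  ((letters d).filter fun b => L.any fun q => decide (q.1 = addL (toL d a) (toL d b))).length

/-- Kernel detected gap count (mirror of `bgap`): letters `b` whose site `w = e_a + e_b` is not the origin, is not remembered,
and is adjacent to a remembered site of age `≥ 2`. [folklore] -/
def bgapK (d : ℕ) (L : KState) (a : Fin d × Bool) : ℕ :=
  ((letters d).filter fun b => !(l1L (addL (toL d a) (toL d b)) == 0) &&
    !(L.any fun q => decide (q.1 = addL (toL d a) (toL d b))) &&
    (L.any fun q => decide (2 ≤ q.2) && adjL d q.1 (addL (toL d a) (toL d b)))).length

/-- Kernel claimed corner (mirror of `bcorner`). [folklore] -/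
def bcornerK (d : ℕ) (L : KState) (a : Fin d × Bool) : Bool :=
  L.any fun q₁ => (q₁.2 == 1) && (q₁.1.getD a.1.1 0 == 0) &&
    (L.all fun q => !decide (q.1 = addL q₁.1 (toL d a))) &&
    L.all fun q => !decide (2 ≤ q.2) || !adjL d q.1 (addL q₁.1 (toL d a))

/-! ### Soundness of the kernel step -/

/-- The kernel rejection test fires iff the new vertex is a remembered site. [folklore] -/
theorem any_reject_iff {L : KState} (hL : WF d L = true) (a : Fin d × Bool) :
    (L.any fun q => decide (q.1 = toL d a)) = true ↔ ∃ q ∈ (toM L : MState d), q.1 = stepVec a := by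
  rw [List.any_eq_true]
  constructor
  · rintro ⟨x, hx, h⟩
    rw [decide_eq_true_eq] at h
    exact ⟨_, mem_toM.2 ⟨x, hx, rfl⟩, by rw [h, toSite_toL]⟩
  · rintro ⟨q, hq, h⟩
    obtain ⟨x, hx, rfl⟩ := mem_toM.1 hq
    refine ⟨x, hx, ?_⟩
    rw [decide_eq_true_eq]
    exact toSite_inj (length_of_WF hL hx) (length_toL a) (by rw [toSite_toL]; exact h)

/-- **The kernel step is the dangerous-set step.** [folklore] -/
theorem mstep_toM {τ : ℕ} {L : KState} (hL : WF d L = true) (a : Fin d × Bool) :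
    mstep τ (toM L : MState d) a = (mstepK τ d L a).map toM := by
  unfold mstep mstepK
  by_cases hrej : (L.any fun q => decide (q.1 = toL d a)) = true
  · rw [if_pos hrej, Option.map_none, if_pos ((any_reject_iff hL a).1 hrej)]
  · rw [if_neg hrej, if_neg (fun h => hrej ((any_reject_iff hL a).2 h)), Option.map_some]
    congr 1
    ext q
    rw [Finset.mem_insert, Finset.mem_filter, Finset.mem_image, mem_toM]
    constructor
    · rintro (rfl | ⟨⟨q', hq', rfl⟩, hjτ, hl⟩)
      · exact ⟨(negL (toL d a), 1), List.mem_cons.2 (Or.inl rfl), by rw [toSite_negL (length_toL a), toSite_toL]⟩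
      · obtain ⟨x, hx, rfl⟩ := mem_toM.1 hq'
        have hxl := length_of_WF hL hx
        simp only at hjτ hl
        refine ⟨(subL x.1 (toL d a), x.2 + 1), List.mem_cons.2 (Or.inr (List.mem_filterMap.2 ⟨x, hx, ?_⟩)), ?_⟩
        · rw [if_pos]
          refine ⟨hjτ, ?_⟩
          rw [← l1_toSite (length_subL hxl (length_toL a)), toSite_subL hxl (length_toL a), toSite_toL]
          exact hl
        · simp only
          rw [toSite_subL hxl (length_toL a), toSite_toL]
    · rintro ⟨x, hx, rfl⟩
      rcases List.mem_cons.1 hx with rfl | hx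
      · left; simp only; rw [toSite_negL (length_toL a), toSite_toL]
      · right
        obtain ⟨y, hy, hyx⟩ := List.mem_filterMap.1 hx
        have hyl := length_of_WF hL hy
        split_ifs at hyx with hcond
        cases hyx
        refine ⟨⟨(toSite y.1, y.2), mem_toM.2 ⟨y, hy, rfl⟩, ?_⟩, hcond.1, ?_⟩
        · simp only
          rw [toSite_subL hyl (length_toL a), toSite_toL]
        · have := hcond.2
          show l1 (toSite (subL y.1 (toL d a)) : Site d) ≤ τ - (y.2 + 1)
          rwa [l1_toSite (length_subL hyl (length_toL a))]

/-! ### Soundness of the counts and the corner flag -/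

/-- Distinct letters give distinct neighbour sites of the new vertex. [folklore] -/
theorem stepVec_add_injective (a : Fin d × Bool) : Function.Injective fun b : Fin d × Bool => stepVec a + stepVec b := by
  intro b b' h
  have h' : stepVec b = stepVec b' := add_left_cancel h
  rcases b with ⟨i, s⟩; rcases b' with ⟨i', s'⟩
  have hi : i = i' := fst_eq_of_stepVec_eq h'
  subst hi
  have := congrFun h' i
  cases s <;> cases s' <;> simp [stepVec] at this ⊢

/-- **The kernel chord count does not exceed the detected chord count.** [folklore] -/
theorem bchordK_le_bchord {L : KState} (hL : WF d L = true) (a : Fin d × Bool) :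
    bchordK d L a ≤ bchord (toM L : MState d) a := by
  classical
  unfold bchordK bchord
  set P : Fin d × Bool → Bool := fun b => L.any fun q => decide (q.1 = addL (toL d a) (toL d b)) with hP
  have hnd : ((letters d).filter fun b => P b).Nodup := nodup_letters.filter _
  rw [← List.toFinset_card_of_nodup hnd]
  -- letters ↪ sites adjacent to the new vertex that are remembered ↪ first components of `bchordSet`
  calc (((letters d).filter fun b => P b).toFinset).card
      ≤ ((bchordSet (toM L : MState d) a).image Prod.fst).card := by
        refine Finset.card_le_card_of_injOn (fun b => stepVec a + stepVec b) (fun b hb => ?_)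
          (fun b _ b' _ h => stepVec_add_injective a h)
        rw [Finset.mem_coe, List.mem_toFinset, List.mem_filter] at hb
        obtain ⟨-, hb⟩ := hb
        rw [hP] at hb
        simp only [List.any_eq_true, decide_eq_true_eq] at hb
        obtain ⟨x, hx, hxe⟩ := hb
        have hxl := length_of_WF hL hx
        rw [Finset.mem_coe, Finset.mem_image]
        refine ⟨(toSite x.1, x.2), ?_, ?_⟩
        · rw [bchordSet, Finset.mem_filter]
          refine ⟨mem_toM.2 ⟨x, hx, rfl⟩, ?_⟩
          simp only
          rw [hxe, toSite_addL (length_toL a) (length_toL b), toSite_toL, toSite_toL]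
          exact ((zdGraph_adj_iff_stepVec _ _).2 ⟨b, rfl⟩).symm
        · simp only
          rw [hxe, toSite_addL (length_toL a) (length_toL b), toSite_toL, toSite_toL]
    _ ≤ (bchordSet (toM L : MState d) a).card := Finset.card_image_le

/-- The list `ℓ¹` test detects the origin. [folklore] -/
theorem toSite_ne_zero_of_l1L {x : List ℤ} (hx : x.length = d) (h : (!(l1L x == 0)) = true) : (toSite x : Site d) ≠ 0 := by
  intro h0
  have : l1 (toSite x : Site d) = 0 := by rw [h0]; simp [l1]
  rw [l1_toSite hx] at this
  simp [this] at h

/-- **The kernel gap count does not exceed the detected gap count.** [folklore] -/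
theorem bgapK_le_bgap {L : KState} (hL : WF d L = true) (a : Fin d × Bool) : bgapK d L a ≤ bgap (toM L : MState d) a := by
  classical
  unfold bgapK bgap
  set P : Fin d × Bool → Bool := fun b => !(l1L (addL (toL d a) (toL d b)) == 0) &&
    !(L.any fun q => decide (q.1 = addL (toL d a) (toL d b))) &&
    (L.any fun q => decide (2 ≤ q.2) && adjL d q.1 (addL (toL d a) (toL d b))) with hP
  have hnd : ((letters d).filter fun b => P b).Nodup := nodup_letters.filter _
  rw [← List.toFinset_card_of_nodup hnd]
  refine Finset.card_le_card_of_injOn (fun b => stepVec a + stepVec b) (fun b hb => ?_)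
    (fun b _ b' _ h => stepVec_add_injective a h)
  rw [Finset.mem_coe, List.mem_toFinset, List.mem_filter] at hb
  obtain ⟨-, hb⟩ := hb
  rw [hP] at hb
  simp only [Bool.and_eq_true, List.any_eq_true, decide_eq_true_eq, Bool.not_eq_true'] at hb
  obtain ⟨⟨h0, hnot⟩, x, hx, hx2, hadj⟩ := hb
  have hlen : (addL (toL d a) (toL d b)).length = d := length_addL (length_toL a) (length_toL b)
  have hsite : (toSite (addL (toL d a) (toL d b)) : Site d) = stepVec a + stepVec b := by
    rw [toSite_addL (length_toL a) (length_toL b), toSite_toL, toSite_toL]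
  rw [Finset.mem_coe, bgapSet, Finset.mem_filter, mem_nbrSites]
  refine ⟨(zdGraph_adj_iff_stepVec _ _).2 ⟨b, rfl⟩, ?_, fun q hq hqe => ?_, (toSite x.1, x.2), mem_toM.2 ⟨x, hx, rfl⟩, hx2, ?_⟩
  · show stepVec a + stepVec b ≠ 0
    rw [← hsite]
    refine toSite_ne_zero_of_l1L hlen ?_
    simpa using h0
  · obtain ⟨y, hy, rfl⟩ := mem_toM.1 hq
    have hyl := length_of_WF hL hy
    have : (L.any fun q => decide (q.1 = addL (toL d a) (toL d b))) = true := by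
      rw [List.any_eq_true]
      refine ⟨y, hy, ?_⟩
      rw [decide_eq_true_eq]
      exact toSite_inj hyl hlen (by rw [hsite]; exact hqe)
    rw [this] at hnot
    exact Bool.noConfusion hnot
  · have := (adj_iff_adjL (length_of_WF hL hx) hlen).2 hadj
    rwa [hsite] at this

/-- **A kernel corner claim is a corner claim.** [folklore] -/
theorem bcorner_of_bcornerK {L : KState} (hL : WF d L = true) (a : Fin d × Bool) (h : bcornerK d L a = true) :
    bcorner (toM L : MState d) a = true := by
  unfold bcornerK at h
  unfold bcorner
  rw [decide_eq_true_iff]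
  rw [List.any_eq_true] at h
  obtain ⟨x, hx, h⟩ := h
  simp only [Bool.and_eq_true, beq_iff_eq, List.all_eq_true, Bool.or_eq_true, Bool.not_eq_true',
    decide_eq_false_iff_not, not_le] at h
  obtain ⟨⟨⟨h1, h0⟩, hnot⟩, hall⟩ := h
  have hxl := length_of_WF hL hx
  have hcl : (addL x.1 (toL d a)).length = d := length_addL hxl (length_toL a)
  have hcs : (toSite (addL x.1 (toL d a)) : Site d) = toSite x.1 + stepVec a := by
    rw [toSite_addL hxl (length_toL a), toSite_toL]
  refine ⟨(toSite x.1, x.2), mem_toM.2 ⟨x, hx, rfl⟩, h1, h0, fun q hq hqe => ?_, fun q hq hq2 hadj => ?_⟩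
  · obtain ⟨y, hy, rfl⟩ := mem_toM.1 hq
    have hyl := length_of_WF hL hy
    exact hnot y hy (toSite_inj hyl hcl (by rw [hcs]; exact hqe))
  · obtain ⟨y, hy, rfl⟩ := mem_toM.1 hq
    have := hall y hy
    rcases this with hlt | hna
    · exact absurd hq2 (by simpa using hlt)
    · have hyl := length_of_WF hL hy
      have h' : adjL d y.1 (addL x.1 (toL d a)) = true := (adj_iff_adjL hyl hcl).1 (by rw [hcs]; exact hadj)
      rw [h'] at hna
      exact Bool.noConfusion hna

/-- The kernel chord count is at most `2d`. [folklore] -/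
theorem bchordK_le (L : KState) (a : Fin d × Bool) : bchordK d L a ≤ 2 * d :=
  (List.length_filter_le _ _).trans (le_of_eq NawK.length_letters)

/-- The kernel gap count is at most `2d`. [folklore] -/
theorem bgapK_le (L : KState) (a : Fin d × Bool) : bgapK d L a ≤ 2 * d :=
  (List.length_filter_le _ _).trans (le_of_eq NawK.length_letters)

end BondK

end Summit.CriticalPhenomena.PercolationContinuityZ3.Theorems.Pcint
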